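import Summits.AtomisticToContinuum.BoseEinsteinCondensation.Theses.BECInfraredBound
import Summits.AtomisticToContinuum.BoseEinsteinCondensation.Theorems.BECCutLineWeakDisorderGroundStateRigidityEssBounded
import Summits.AtomisticToContinuum.BoseEinsteinCondensation.Theorems.BECInsertionCorrectorCorrectorClosureVolumeBootstrap
import Literature.MathematicalPhysics.QuantumManyBody.TorusBoseFockLayer
import Literature.MathematicalPhysics.QuantumManyBody.BoseGasCatStates
import Literature.MathematicalPhysics.QuantumManyBody.NeumannMomentumCutoffs
import Literature.MathematicalPhysics.QuantumManyBody.BoseGasFreeProductState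
import Literature.MathematicalPhysics.QuantumManyBody.BoseGasThermodynamicLimitRuelle
import Literature.MathematicalPhysics.QuantumManyBody.BoseGasMergeOccupation
import HarnessLib

/-!
# `BecFreeGas` (stmt-AtomisticToContinuum-8912): the free Dirichlet gas condenses in the flat mode

Route `BECInfraredBound` of `AtomisticToContinuum/BoseEinsteinCondensation` (rank-9 branch of `closes`);
the decl is shared as `FreeGasZeroMode` / `BecFreeGas` by `BECStoquasticCensoring`,
`BECEqualScatteringTransfer`, `BECHierarchicalRetention`.  Line `torus-poincare-quarter` of the crux chain
(crux-ideate k=2, round 1), landed by the line lead.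

**Statement.** For every repulsive finite-range `v` that is a.e. zero on `(0,∞)`: at every density
`ρ < ρ₀ := 1`, with `c := 1/5`, eventually in `N`, every Dirichlet `δ_N`-near-minimiser `Ψ` of the energy in
the box of side `L_N = (N/ρ)^{1/3}` (`δ_N := π²N/(10 L_N²)`) has flat-mode occupation
`⟨φ₀, γ_Ψ φ₀⟩ ≥ N/5`, `φ₀ = 1_{Λ_L} L^{-3/2}`.

**The lever.** A Dirichlet trial state of the box `Λ_L` IS a periodic state of the torus of side `L`
(`TrialState.toPeriodic`, equal to `Ψ` on the cell), and on the torus the depletion of the constant mode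
costs kinetic energy at the SHARP rate `(2π/L)²` (Parseval: `N - n₀ = Σ_{k≠0} n_k`,
`∫|∇Ψ|² = Σ_k |k|² n_k`, `|k| ≥ 2π/L`): `N ≤ n₀(Ψ) + (L/2π)² · energy 0 Ψ` for EVERY Dirichlet `Ψ`
(`natCast_le_occupation_flatMode_add`).  The free Dirichlet ground-state energy per particle `3π²/L²`
lies strictly BELOW the first torus level `4π²/L²` (`3 < 4`, i.e. `dπ² < 4π²` in `d = 3`), so a Dirichlet
`δ`-near-minimiser with `δ = π²N/(10L²)` and `E₀^D ≤ 3π²N(1 + 1/30)/L²`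
(`groundStateEnergy_zero_le_of_ge`, valid for `L ≥ L₀`) has `N - n₀ ≤ (L/2π)²·3.2π²N/L² = 0.8N`:
`n₀ ≥ N/5`.  No gap argument, no sine mode, no identification of the minimiser, no mode transfer.

**Glue** (`energy_eq_energy_zero`): for `v` a.e. zero on `(0,∞)`, `energy v = energy 0`
(`GroundStateRigidity.energy_congr_offNull`: pair-distance preimages of null sets of radii are null in
`(ℝ³)^N`, the collision planes included), so the crux is the free gas at every density (`ρ₀ := 1`).

Main theorem: `BecFreeGas_proof : BECInfraredBound.BecFreeGas`.
References: LSSY2005 App. A (A.6), (A.10), (A.11) (torus Parseval bookkeeping); the Dirichlet/torus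
comparison `3π² < 4π²` is folklore.
-/

noncomputable section

open MeasureTheory Filter
open scoped ENNReal NNReal ComplexConjugate

namespace Summit.AtomisticToContinuum.BoseEinsteinCondensation.Theorems

open Literature.MathematicalPhysics.QuantumManyBody.BoseGas

namespace BecFreeGas

/-! ### Dirichlet states are periodic states: the flat-mode Poincaré inequality in the box -/

/-- **Sharp flat-mode Poincaré inequality for Dirichlet states** (cell-mode form): for every Dirichlet
trial state `Ψ` of `Λ_L`, `N ≤ ⟨Ψ, n₀Ψ⟩ + (L/2π)² · energy 0 Ψ`. The periodisation of `Ψ` equals `Ψ` on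
the cell (`indicator_cellN_periodize`), its kinetic energy on the cell is at most `energy 0 Ψ`
(`periodicEnergy_toPeriodic_le` at `R₀ = 0`), and on the torus `N - n₀ ≤ (L/2π)² ∫_{cell^N} |∇Ψ|²`
(the landed `CorrectorClosure.VolumeHomotopySumRuleDomination.vb_depletion_le`: Parseval `N - n₀ = Σ_{k≠0} n_k`,
`∫|∇Ψ|² = Σ_k |k|² n_k`, `|k| ≥ 2π/L`; LSSY2005 App. A (A.6), (A.10), (A.11)). [folklore] -/
theorem natCast_le_occupation_constantMode_add {N : ℕ} {L : ℝ} (hL : 0 < L) (Ψ : TrialState N L) :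
    (N : ℝ≥0∞) ≤ occupation N (constantMode L) Ψ.ψ +
      ENNReal.ofReal ((L / (2 * Real.pi)) ^ 2) * energy 0 Ψ := by
  have h := CorrectorClosure.VolumeHomotopySumRuleDomination.vb_depletion_le hL (Ψ.toPeriodic hL le_rfl)
  have hocc : condensateOccupation N L (Ψ.toPeriodic hL le_rfl).ψ =
      occupation N (constantMode L) Ψ.ψ := by
    show occupation N (constantMode L) ((cellN N L).indicator (periodize L Ψ.ψ)) = _
    rw [indicator_cellN_periodize Ψ hL]
  have hkin : (∫⁻ X in cellN N L, kineticDensity (Ψ.toPeriodic hL le_rfl).ψ X) ≤ energy 0 Ψ :=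
    calc (∫⁻ X in cellN N L, kineticDensity (Ψ.toPeriodic hL le_rfl).ψ X)
        ≤ periodicEnergy 0 (Ψ.toPeriodic hL le_rfl) := lintegral_mono fun _ => le_self_add
      _ ≤ energy 0 Ψ :=
          Ψ.periodicEnergy_toPeriodic_le (R₀ := 0) (fun _ _ => rfl) hL le_rfl (by linarith)
  rw [hocc] at h
  calc (N : ℝ≥0∞)
      ≤ occupation N (constantMode L) Ψ.ψ + ((N : ℝ≥0∞) - occupation N (constantMode L) Ψ.ψ) :=
        le_add_tsub
    _ ≤ occupation N (constantMode L) Ψ.ψ +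
        ENNReal.ofReal ((L / (2 * Real.pi)) ^ 2) * energy 0 Ψ :=
        add_le_add le_rfl (h.trans (mul_le_mul' le_rfl hkin))

/-- The same with the crux's box flat mode `φ₀ = 1_{Λ_L} L^{-3/2}` (`box =ᵐ cell`). [folklore] -/
theorem natCast_le_occupation_flatMode_add {N : ℕ} {L : ℝ} (hL : 0 < L) (Ψ : TrialState N L) :
    (N : ℝ≥0∞) ≤ occupation N ((box L).indicator fun _ => ((Real.sqrt (L ^ 3))⁻¹ : ℂ)) Ψ.ψ +
      ENNReal.ofReal ((L / (2 * Real.pi)) ^ 2) * energy 0 Ψ := by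
  have hae : ((box L).indicator fun _ => ((Real.sqrt (L ^ 3))⁻¹ : ℂ)) =ᵐ[volume] constantMode L :=
    indicator_ae_eq_of_ae_eq_set
      (Literature.MathematicalPhysics.QuantumManyBody.NeumannBox.box_ae_eq_cell L)
  rw [occupation_congr_ae hae]
  exact natCast_le_occupation_constantMode_add hL Ψ

/-! ### `3π² < 4π²`: a fifth of the free gas is in the flat mode -/

/-- At fixed `N`, `L`: if `E₀^D(0,N,L) ≤ 3π²N(1 + 1/30)/L²`, every Dirichlet `δ`-near-minimiser of the
free energy with `δ = π²N/(10L²)` has `n_{φ₀} ≥ N/5` (`(L/2π)²·(3·31/30 + 1/10)π²N/L² = 0.8N`). [folklore] -/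
theorem fifth_le_occupation_flatMode {N : ℕ} {L : ℝ} (hL : 0 < L) (Ψ : TrialState N L)
    (hE0 : groundStateEnergy 0 N L ≤ ENNReal.ofReal (3 * N * (Real.pi / L) ^ 2 * (1 + 1 / 30)))
    (hΨ : energy 0 Ψ ≤ groundStateEnergy 0 N L + ENNReal.ofReal (Real.pi ^ 2 * N / (10 * L ^ 2))) :
    ENNReal.ofReal ((1 / 5 : ℝ) * N) ≤
      occupation N ((box L).indicator fun _ => ((Real.sqrt (L ^ 3))⁻¹ : ℂ)) Ψ.ψ := by
  have hNn : (0 : ℝ) ≤ N := Nat.cast_nonneg N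
  have hπ : Real.pi ≠ 0 := Real.pi_pos.ne'
  have hL0 : L ≠ 0 := hL.ne'
  have hEΨ : energy 0 Ψ ≤ ENNReal.ofReal (16 * Real.pi ^ 2 * N / (5 * L ^ 2)) := by
    calc energy 0 Ψ
        ≤ groundStateEnergy 0 N L + ENNReal.ofReal (Real.pi ^ 2 * N / (10 * L ^ 2)) := hΨ
      _ ≤ ENNReal.ofReal (3 * N * (Real.pi / L) ^ 2 * (1 + 1 / 30)) +
            ENNReal.ofReal (Real.pi ^ 2 * N / (10 * L ^ 2)) := add_le_add hE0 le_rfl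
      _ = ENNReal.ofReal (16 * Real.pi ^ 2 * N / (5 * L ^ 2)) := by
          rw [← ENNReal.ofReal_add (by positivity) (by positivity)]
          congr 1
          field_simp
          ring
  have hP := natCast_le_occupation_flatMode_add hL Ψ
  have hprod : ENNReal.ofReal ((L / (2 * Real.pi)) ^ 2) *
      ENNReal.ofReal (16 * Real.pi ^ 2 * N / (5 * L ^ 2)) = ENNReal.ofReal ((4 / 5 : ℝ) * N) := by
    rw [← ENNReal.ofReal_mul (sq_nonneg _)]
    congr 1
    field_simp
    ring
  have h1 : (N : ℝ≥0∞) ≤ occupation N ((box L).indicator fun _ => ((Real.sqrt (L ^ 3))⁻¹ : ℂ)) Ψ.ψ +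
      ENNReal.ofReal ((4 / 5 : ℝ) * N) :=
    hP.trans (add_le_add le_rfl ((mul_le_mul' le_rfl hEΨ).trans hprod.le))
  have hsplit : (N : ℝ≥0∞) = ENNReal.ofReal ((1 / 5 : ℝ) * N) + ENNReal.ofReal ((4 / 5 : ℝ) * N) := by
    rw [← ENNReal.ofReal_add (by positivity) (by positivity), ← ENNReal.ofReal_natCast]
    congr 1
    ring
  rw [hsplit] at h1
  exact (ENNReal.add_le_add_iff_right ENNReal.ofReal_ne_top).1 h1

/-- **Free-gas core in the thermodynamic window**: at every density `ρ > 0`, eventually in `N`, every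
Dirichlet `δ_N`-near-minimiser of the FREE energy in the box of side `L_N = (N/ρ)^{1/3}`,
`δ_N = π²N/(10L_N²)`, has flat-mode occupation `≥ N/5` (`groundStateEnergy_zero_le_of_ge` at `η = 1/30`
and `L_N → ∞`). [folklore] -/
theorem eventually_fifth_le_occupation_flatMode (ρ : ℝ) (hρ : 0 < ρ) :
    ∀ᶠ N : ℕ in atTop, ∀ Ψ : TrialState N (sideLength ρ N),
      energy 0 Ψ ≤ groundStateEnergy 0 N (sideLength ρ N) +
          ENNReal.ofReal (Real.pi ^ 2 * N / (10 * sideLength ρ N ^ 2)) →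
        ENNReal.ofReal ((1 / 5 : ℝ) * N) ≤
          occupation N ((box (sideLength ρ N)).indicator
            fun _ => ((Real.sqrt (sideLength ρ N ^ 3))⁻¹ : ℂ)) Ψ.ψ := by
  obtain ⟨L₀, hL₀, hE⟩ := groundStateEnergy_zero_le_of_ge (η := 1 / 30) (by norm_num)
  filter_upwards [(tendsto_sideLength_atTop hρ).eventually_ge_atTop L₀] with N hN Ψ hΨ
  exact fifth_le_occupation_flatMode (hL₀.trans_le hN) Ψ (hE _ hN N) hΨ

/-! ### Glue: the interaction is invisible when `v` is a.e. zero on `(0, ∞)` (from `Lines/birth.lean`) -/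

/-- **The interaction is invisible when `v` is a.e. zero on `(0, ∞)`** (birth line glue, verbatim): the
exceptional radii form a Lebesgue-null set off which `v` agrees with a potential vanishing on `[0, ∞)`,
whose interaction is identically zero; `GroundStateRigidity.energy_congr_offNull` does the measure theory.
[folklore] -/
theorem energy_eq_energy_zero {v : ℝ → ℝ≥0∞} (hv : IsRepulsiveFiniteRange v)
    (hae : ∀ᵐ r ∂(volume.restrict (Set.Ioi (0 : ℝ))), v r = 0) {N : ℕ} {L : ℝ}
    (Ψ : TrialState N L) : energy v Ψ = energy 0 Ψ := by
  have hSm : MeasurableSet (({0} : Set ℝ) ∪ (Set.Ioi 0 ∩ v ⁻¹' {0}ᶜ)) :=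
    (measurableSet_singleton 0).union (measurableSet_Ioi.inter (hv.1 (measurableSet_singleton 0).compl))
  have hpos : volume (Set.Ioi (0 : ℝ) ∩ v ⁻¹' {0}ᶜ) = 0 := by
    have h1 : (volume.restrict (Set.Ioi (0 : ℝ))) {r | ¬ v r = 0} = 0 := ae_iff.1 hae
    rw [Measure.restrict_apply' measurableSet_Ioi] at h1
    refine measure_mono_null (fun r hr => ?_) h1
    exact ⟨hr.2, hr.1⟩
  have hS0 : volume (({0} : Set ℝ) ∪ (Set.Ioi 0 ∩ v ⁻¹' {0}ᶜ)) = 0 :=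
    measure_union_null Real.volume_singleton hpos
  have hvw : ∀ r, r ∉ (({0} : Set ℝ) ∪ (Set.Ioi 0 ∩ v ⁻¹' {0}ᶜ)) →
      v r = (fun s : ℝ => if 0 ≤ s then (0 : ℝ≥0∞) else v s) r := by
    intro r hr
    by_cases h0 : 0 ≤ r
    · have hv0 : v r = 0 := by
        by_contra hne
        rcases h0.eq_or_lt with h00 | h00
        · exact hr (Set.mem_union_left _ (Set.mem_singleton_iff.2 h00.symm))
        · exact hr (Set.mem_union_right _ (Set.mem_inter (Set.mem_Ioi.2 h00) (by simpa using hne)))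
      simp only [if_pos h0, hv0]
    · simp only [if_neg h0]
  have h1 : energy v Ψ = energy (fun s : ℝ => if 0 ≤ s then (0 : ℝ≥0∞) else v s) Ψ :=
    Summit.AtomisticToContinuum.BoseEinsteinCondensation.Theorems.GroundStateRigidity.energy_congr_offNull
      hSm hS0 hvw Ψ
  have hw0 : ∀ X : Config N, interaction (fun s : ℝ => if 0 ≤ s then (0 : ℝ≥0∞) else v s) X = 0 := by
    intro X
    unfold interaction
    exact Finset.sum_eq_zero fun i _ => Finset.sum_eq_zero fun j _ => by simp [dist_nonneg]
  have h2 : energy (fun s : ℝ => if 0 ≤ s then (0 : ℝ≥0∞) else v s) Ψ = energy 0 Ψ := by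
    simp only [energy, hw0, interaction_zeroPotential]
  rw [h1, h2]

/-- … hence the ground-state energies agree too. [folklore] -/
theorem groundStateEnergy_eq_zero {v : ℝ → ℝ≥0∞} (hv : IsRepulsiveFiniteRange v)
    (hae : ∀ᵐ r ∂(volume.restrict (Set.Ioi (0 : ℝ))), v r = 0) (N : ℕ) (L : ℝ) :
    groundStateEnergy v N L = groundStateEnergy 0 N L := by
  unfold groundStateEnergy
  exact iInf_congr fun Φ => energy_eq_energy_zero hv hae Φ

end BecFreeGas

/-! ### The crux by name -/

open BecFreeGas in
/-- **`BecFreeGas`** (X_B1 at every `v` a.e. zero on `(0,∞)`): `ρ₀ := 1` (any value), `c := 1/5`,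
`δ_N := π²N/(10L_N²)`. [folklore] -/
theorem BecFreeGas_proof :
    Summit.AtomisticToContinuum.BoseEinsteinCondensation.Theses.BECInfraredBound.BecFreeGas := by
  intro v hv hae
  refine ⟨1, one_pos, fun ρ hρ _ => ⟨1 / 5, by norm_num, ?_⟩⟩
  filter_upwards [eventually_fifth_le_occupation_flatMode ρ hρ, eventually_gt_atTop 0] with N hN hN0
  have hL : 0 < sideLength ρ N := sideLength_pos_of_pos hρ hN0
  have hNpos : (0 : ℝ) < N := Nat.cast_pos.2 hN0
  refine ⟨ENNReal.ofReal (Real.pi ^ 2 * N / (10 * sideLength ρ N ^ 2)),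
    ENNReal.ofReal_pos.2 (div_pos (mul_pos (pow_pos Real.pi_pos 2) hNpos)
      (mul_pos (by norm_num) (pow_pos hL 2))), fun Ψ hΨ => ?_⟩
  rw [energy_eq_energy_zero hv hae Ψ, groundStateEnergy_eq_zero hv hae N (sideLength ρ N)] at hΨ
  exact hN Ψ hΨ

end Summit.AtomisticToContinuum.BoseEinsteinCondensation.Theorems

end
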